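import Mathlib.NumberTheory.Harmonic.Bounds
import Mathlib.Analysis.PSeries
import Literature.NumberTheory.LFunctions.RodgersTaoEnergyProofs
import HarnessLib

/-!
# Rodgers–Tao 2020, proof of Proposition 15 (FMP pp. 38–39): consequences of the location law —
stage S3 of the P6.1 content twin

RH-FREE literature PROOFS (no definitions, no named facts). Trunk T-ANT
(`Literature/NumberTheory/LFunctions`); stage **S3** of rt-lead ruling (52)(a) (rt/STATUS
2026-08-26) for rt-t4's `RodgersTaoWeakEnergyBoundProofs.lean` (content twin of
`rodgers_tao_weak_energy_bound` = B. Rodgers, T. Tao, *The de Bruijn–Newman constant is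
non-negative*, Forum Math. Pi 8 (2020) e6 = arXiv:1801.05914, Proposition 15, proof FMP pp. 38–39
= v5 TeX l.950–977), companion of `RodgersTaoWeakEnergyPigeonholeProofs.lean` (S2).

The printed proof uses the location law (add) = FMP eq. (50), Corollary 10
(`x_j(t) = ξ_j + O(log₊ ξ_j)` uniformly for `Λ < t ≤ 0`) three times: for the crude lower bound
(«From (add) we have a crude lower bound `Q_{[J,2J]_{ℤ*}} ≫ J log^{−O(1)} J`», consecutive gaps
are `O(log J)`), for the
contribution of the indices `j` outside `K′` («Using (add), the contribution to the integral of
those `j` outside of `K′` may be crudely bounded by `O(J² log^{O(1)} J)`»), and — in the repaired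
form of the `ab ≪ a² + b²` step (ERRATA E13, rt-ref row 74: the far indices need (add), not only
`ab ≪ a² + b²`) — for `|x_j − x_k| ≫ |j − k|/log J` once `|j − k| ≳ log² J`.

Everything here is stated ABSTRACTLY over sequences `x ξ : ℕ → ℝ` with an explicit location
hypothesis `|x k − ξ k| ≤ E` and explicit spacing hypotheses `g ≤ ξ (k+1) − ξ k ≤ G` on a block of
indices (§§ A–E, Mathlib only), plus (§ F) the spacing constants for the classical locations
`ξ_j` of eq. (10) from the `RodgersTaoEnergyProofs` API: `4π/log(ξ_{j+1}/4π) ≤ ξ_{j+1} − ξ_j ≤ 4π`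
(`j ≥ 0`) and `log(ξ_j/4π) ≤ log 4T` for `j ≤ 4T log T`. The assembly (S4) instantiates
`x k = x_k(t)`, `E = B log J`, `g = 4π/log 4T`, `G = 4π`.

Relation to `RodgersTaoGapBoundProofs.lean` §A (rt-t2, p442229): that module bounds ENERGY sums
`Σ_{j ∉ [a,b]} E_{jk}` against the environment of an interval through its outer gaps `m` and the
far pointwise bounds `interactionEnergy_far_right/left/neg`, over the carriers `deBruijnZeroZ`,
`classicalLocation`, with Lemma 8 in the existential-constant shapes `lemma8_i_order`,
`lemma8_ii_pos`. Nothing of it is restated here: this module supplies the UNSQUARED far sums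
`Σ_far 1/|x_j − x_k| ≪ log² J` of the repaired Cauchy–Schwarz step (E13), the consecutive-gap
upper bound behind the crude lower bound for `Q_{[J,2J]}`, and explicit spacing constants for
`ξ_j` including the UPPER bound `ξ_{j+1} − ξ_j ≤ 4π`, all over abstract sequences so that the
assembly (S4) instantiates them next to §A.

## Main results

* § A perturbation: `abs_sub_sub_two_mul_le_abs_sub`, `sub_sub_two_mul_le_sub`,
  `sub_le_sub_add_two_mul`;
* § B spacing accumulation: `mul_sub_le_sub_of_le_gaps`, `sub_le_mul_sub_of_gaps_le`;
* § C index-distance lower bound: `half_mul_dist_le_abs_sub_of_location`;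
* § D far sums: `sum_inv_le_of_mul_le`, `sum_inv_sq_le_of_mul_le`, `sum_inv_dist_le_two_mul_harmonic`,
  `sum_inv_dist_le_log`, `sum_inv_dist_sq_le`;
* § E consecutive gaps: `succ_sub_le_of_location`, `succ_sub_pos_of_location`;
* § F classical locations: `exists_classicalLocation_succ_sub_eq`,
  `four_pi_div_log_le_classicalLocation_succ_sub`, `classicalLocation_succ_sub_le_four_pi`,
  `log_classicalLocation_div_four_pi_le`, `classicalLocation_gaps_window`.

LABEL: RH-FREE CONTENT (0 facts). bears_on: N-C/N-P (COLUMN 3 DBN).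
WHAT THIS IS NOT: location-law bookkeeping for Rodgers–Tao's RH-free integrated-energy bound
(VACUOUS-AS-PRINTED on `[Λ/2, 0]` since `Λ ≥ 0` is a kernel theorem); nothing here bears on the
truth of RH.
-/

noncomputable section

open Real Filter Set Finset

namespace Literature.NumberTheory.LFunctions

/-! ## § A. Perturbation: zeros versus classical locations -/

/-- If `|x_j − ξ_j| ≤ E` and `|x_k − ξ_k| ≤ E` then `|ξ_j − ξ_k| − 2E ≤ |x_j − x_k|` (the location
law (add) transfers spacing of the `ξ_j` to the zeros).
[cite: RodgersTaoFMP2020, §6 proof of Prop. 15, FMP pp. 38–39 (uses of eq. (50) = arXiv (add))] -/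
theorem abs_sub_sub_two_mul_le_abs_sub {xj xk ξj ξk E : ℝ} (hj : |xj - ξj| ≤ E)
    (hk : |xk - ξk| ≤ E) : |ξj - ξk| - 2 * E ≤ |xj - xk| := by
  have h1 : |ξj - ξk| ≤ |ξj - xj| + |xj - xk| + |xk - ξk| := by
    calc |ξj - ξk| = |(ξj - xj) + (xj - xk) + (xk - ξk)| := by ring_nf
      _ ≤ |(ξj - xj) + (xj - xk)| + |xk - ξk| := abs_add_le _ _
      _ ≤ |ξj - xj| + |xj - xk| + |xk - ξk| := by linarith [abs_add_le (ξj - xj) (xj - xk)]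
  rw [abs_sub_comm ξj xj] at h1
  linarith

/-- One-sided form: `(ξ_k − ξ_j) − 2E ≤ x_k − x_j`.
[cite: RodgersTaoFMP2020, §6 proof of Prop. 15, FMP pp. 38–39 (uses of eq. (50) = arXiv (add))] -/
theorem sub_sub_two_mul_le_sub {xj xk ξj ξk E : ℝ} (hj : |xj - ξj| ≤ E) (hk : |xk - ξk| ≤ E) :
    (ξk - ξj) - 2 * E ≤ xk - xj := by
  have h1 := (abs_le.1 hj).2
  have h2 := (abs_le.1 hk).1
  linarith

/-- One-sided form: `x_k − x_j ≤ (ξ_k − ξ_j) + 2E`.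
[cite: RodgersTaoFMP2020, §6 proof of Prop. 15, FMP pp. 38–39 (uses of eq. (50) = arXiv (add))] -/
theorem sub_le_sub_add_two_mul {xj xk ξj ξk E : ℝ} (hj : |xj - ξj| ≤ E) (hk : |xk - ξk| ≤ E) :
    xk - xj ≤ (ξk - ξj) + 2 * E := by
  have h1 := (abs_le.1 hj).1
  have h2 := (abs_le.1 hk).2
  linarith

/-! ## § B. Spacing accumulation along a block of indices -/

/-- Lower spacing accumulates: if `g ≤ ξ (k+1) − ξ k` for `a ≤ k < b`, then
`g · (k − j) ≤ ξ k − ξ j` for `a ≤ j ≤ k ≤ b`.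
[cite: RodgersTaoFMP2020, §6 proof of Prop. 15, FMP pp. 38–39 (uses of eq. (50) = arXiv (add))] -/
theorem mul_sub_le_sub_of_le_gaps {ξ : ℕ → ℝ} {g : ℝ} {a b : ℕ}
    (h : ∀ k, a ≤ k → k < b → g ≤ ξ (k + 1) - ξ k) {j k : ℕ} (hj : a ≤ j) (hjk : j ≤ k)
    (hk : k ≤ b) : g * ((k : ℝ) - j) ≤ ξ k - ξ j := by
  obtain ⟨n, rfl⟩ := Nat.exists_eq_add_of_le hjk
  induction n with
  | zero => simp
  | succ n ih =>
    have h1 := ih (by omega) (by omega)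
    have h2 := h (j + n) (by omega) (by omega)
    rw [show j + (n + 1) = j + n + 1 from rfl]
    push_cast at h1 ⊢
    linarith

/-- Upper spacing accumulates: if `ξ (k+1) − ξ k ≤ G` for `a ≤ k < b`, then
`ξ k − ξ j ≤ G · (k − j)` for `a ≤ j ≤ k ≤ b`.
[cite: RodgersTaoFMP2020, §6 proof of Prop. 15, FMP pp. 38–39 (uses of eq. (50) = arXiv (add))] -/
theorem sub_le_mul_sub_of_gaps_le {ξ : ℕ → ℝ} {G : ℝ} {a b : ℕ}
    (h : ∀ k, a ≤ k → k < b → ξ (k + 1) - ξ k ≤ G) {j k : ℕ} (hj : a ≤ j) (hjk : j ≤ k)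
    (hk : k ≤ b) : ξ k - ξ j ≤ G * ((k : ℝ) - j) := by
  obtain ⟨n, rfl⟩ := Nat.exists_eq_add_of_le hjk
  induction n with
  | zero => simp
  | succ n ih =>
    have h1 := ih (by omega) (by omega)
    have h2 := h (j + n) (by omega) (by omega)
    rw [show j + (n + 1) = j + n + 1 from rfl]
    push_cast at h1 ⊢
    linarith

/-! ## § C. Index-distance lower bound for the gaps between zeros -/

/-- **Index-distance lower bound** (the repaired far-index step, ERRATA E13): on a block
`a ≤ · ≤ b` where `|x k − ξ k| ≤ E` and the `ξ`-gaps are `≥ g ≥ 0`, any two indices with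
`g · |j − k| ≥ 4E` satisfy `g · |j − k| / 2 ≤ |x j − x k|` (printed: `E ≍ log J`, `g ≍ 1/log J`,
so this is `|x_j − x_k| ≫ |j − k|/log J` for `|j − k| ≳ log² J`).
[cite: RodgersTaoFMP2020, §6 proof of Prop. 15, FMP p. 39 (uses of eq. (50) = arXiv (add))] -/
theorem half_mul_dist_le_abs_sub_of_location {x ξ : ℕ → ℝ} {g E : ℝ} {a b : ℕ}
    (hgap : ∀ k, a ≤ k → k < b → g ≤ ξ (k + 1) - ξ k)
    (hloc : ∀ k, a ≤ k → k ≤ b → |x k - ξ k| ≤ E) {j k : ℕ} (hj : a ≤ j) (hjb : j ≤ b)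
    (hk : a ≤ k) (hkb : k ≤ b) (hfar : 4 * E ≤ g * |(j : ℝ) - k|) :
    g * |(j : ℝ) - k| / 2 ≤ |x j - x k| := by
  have key : ∀ j k : ℕ, a ≤ j → j ≤ k → k ≤ b → 4 * E ≤ g * ((k : ℝ) - j) →
      g * ((k : ℝ) - j) / 2 ≤ |x j - x k| := by
    intro j k hj hjk hkb hfar
    have h1 : g * ((k : ℝ) - j) ≤ ξ k - ξ j := mul_sub_le_sub_of_le_gaps hgap hj hjk hkb
    have h2 : |ξ j - ξ k| - 2 * E ≤ |x j - x k| :=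
      abs_sub_sub_two_mul_le_abs_sub (hloc j hj (hjk.trans hkb)) (hloc k (hj.trans hjk) hkb)
    have h3 : ξ k - ξ j ≤ |ξ j - ξ k| := by rw [abs_sub_comm]; exact le_abs_self _
    linarith
  rcases le_total j k with hjk | hkj
  · have e : |(j : ℝ) - k| = (k : ℝ) - j := by
      rw [abs_sub_comm, abs_of_nonneg (sub_nonneg.2 (by exact_mod_cast hjk))]
    rw [e] at hfar ⊢
    exact key j k hj hjk hkb hfar
  · have e : |(j : ℝ) - k| = (j : ℝ) - k := abs_of_nonneg (sub_nonneg.2 (by exact_mod_cast hkj))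
    rw [e] at hfar ⊢
    rw [abs_sub_comm]
    exact key k j hk hkj hjb hfar

/-! ## § D. Far sums -/

/-- Comparison of reciprocal sums: `c · d k ≤ a k` with `d k > 0`, `c > 0` on `S` gives
`Σ_{k∈S} (a k)⁻¹ ≤ c⁻¹ Σ_{k∈S} (d k)⁻¹`.
[cite: RodgersTaoFMP2020, §6 proof of Prop. 15, FMP p. 39 (uses of eq. (50) = arXiv (add))] -/
theorem sum_inv_le_of_mul_le {ι : Type*} (S : Finset ι) {a d : ι → ℝ} {c : ℝ} (hc : 0 < c)
    (h : ∀ k ∈ S, c * d k ≤ a k) (hd : ∀ k ∈ S, 0 < d k) :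
    ∑ k ∈ S, (a k)⁻¹ ≤ c⁻¹ * ∑ k ∈ S, (d k)⁻¹ := by
  rw [Finset.mul_sum]
  refine Finset.sum_le_sum fun k hk ↦ ?_
  rw [← mul_inv]
  exact inv_anti₀ (mul_pos hc (hd k hk)) (h k hk)

/-- Comparison of reciprocal-square sums: `c · d k ≤ a k` with `d k > 0`, `c > 0` on `S` gives
`Σ_{k∈S} (a k)⁻² ≤ c⁻² Σ_{k∈S} (d k)⁻²`.
[cite: RodgersTaoFMP2020, §6 proof of Prop. 15, FMP p. 39 (uses of eq. (50) = arXiv (add))] -/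
theorem sum_inv_sq_le_of_mul_le {ι : Type*} (S : Finset ι) {a d : ι → ℝ} {c : ℝ} (hc : 0 < c)
    (h : ∀ k ∈ S, c * d k ≤ a k) (hd : ∀ k ∈ S, 0 < d k) :
    ∑ k ∈ S, (a k ^ 2)⁻¹ ≤ (c ^ 2)⁻¹ * ∑ k ∈ S, (d k ^ 2)⁻¹ := by
  rw [Finset.mul_sum]
  refine Finset.sum_le_sum fun k hk ↦ ?_
  rw [← mul_inv, ← mul_pow]
  have h0 : 0 < c * d k := mul_pos hc (hd k hk)
  exact inv_anti₀ (pow_pos h0 2) (pow_le_pow_left₀ h0.le (h k hk) 2)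

/-- One-sided harmonic bound: for `S ⊆ (j, j+N]`, `Σ_{k∈S} (k − j)⁻¹ ≤ harmonic N`. [folklore] -/
private theorem sum_inv_sub_le_harmonic_right (S : Finset ℕ) (j N : ℕ)
    (hS : ∀ k ∈ S, j < k ∧ k ≤ j + N) :
    ∑ k ∈ S, (((k : ℝ) - j))⁻¹ ≤ (harmonic N : ℝ) := by
  have hinj : Set.InjOn (fun k : ℕ ↦ k - j) S := by
    intro k hk k' hk' h
    have := (hS k hk).1; have := (hS k' hk').1
    simp only at h; omega
  have himg : S.image (fun k ↦ k - j) ⊆ Finset.Icc 1 N := by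
    intro n hn
    obtain ⟨k, hk, rfl⟩ := Finset.mem_image.1 hn
    have := hS k hk
    simp only [Finset.mem_Icc]; omega
  calc ∑ k ∈ S, (((k : ℝ) - j))⁻¹ = ∑ n ∈ S.image (fun k ↦ k - j), ((n : ℕ) : ℝ)⁻¹ := by
        rw [Finset.sum_image hinj]
        refine Finset.sum_congr rfl fun k hk ↦ ?_
        rw [Nat.cast_sub (hS k hk).1.le]
    _ ≤ ∑ n ∈ Finset.Icc 1 N, ((n : ℕ) : ℝ)⁻¹ :=
        Finset.sum_le_sum_of_subset_of_nonneg himg fun n _ _ ↦ by positivity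
    _ = (harmonic N : ℝ) := by
        rw [harmonic_eq_sum_Icc]; push_cast; rfl

/-- One-sided harmonic bound: for `S ⊆ [j−N, j)`, `Σ_{k∈S} (j − k)⁻¹ ≤ harmonic N`. [folklore] -/
private theorem sum_inv_sub_le_harmonic_left (S : Finset ℕ) (j N : ℕ)
    (hS : ∀ k ∈ S, k < j ∧ j ≤ k + N) :
    ∑ k ∈ S, (((j : ℝ) - k))⁻¹ ≤ (harmonic N : ℝ) := by
  have hinj : Set.InjOn (fun k : ℕ ↦ j - k) S := by
    intro k hk k' hk' h
    have := (hS k hk).1; have := (hS k' hk').1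
    simp only at h; omega
  have himg : S.image (fun k ↦ j - k) ⊆ Finset.Icc 1 N := by
    intro n hn
    obtain ⟨k, hk, rfl⟩ := Finset.mem_image.1 hn
    have := hS k hk
    simp only [Finset.mem_Icc]; omega
  calc ∑ k ∈ S, (((j : ℝ) - k))⁻¹ = ∑ n ∈ S.image (fun k ↦ j - k), ((n : ℕ) : ℝ)⁻¹ := by
        rw [Finset.sum_image hinj]
        refine Finset.sum_congr rfl fun k hk ↦ ?_
        rw [Nat.cast_sub (hS k hk).1.le]
    _ ≤ ∑ n ∈ Finset.Icc 1 N, ((n : ℕ) : ℝ)⁻¹ :=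
        Finset.sum_le_sum_of_subset_of_nonneg himg fun n _ _ ↦ by positivity
    _ = (harmonic N : ℝ) := by
        rw [harmonic_eq_sum_Icc]; push_cast; rfl

/-- **Harmonic far-sum bound**: for a set `S` of indices `k ≠ j` with `|j − k| ≤ N`,
`Σ_{k∈S} |j − k|⁻¹ ≤ 2 · harmonic N`.
[cite: RodgersTaoFMP2020, §6 proof of Prop. 15, FMP p. 39 (uses of eq. (50) = arXiv (add))] -/
theorem sum_inv_dist_le_two_mul_harmonic (S : Finset ℕ) (j N : ℕ)
    (hS : ∀ k ∈ S, k ≠ j ∧ (j : ℤ) - N ≤ k ∧ (k : ℤ) ≤ j + N) :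
    ∑ k ∈ S, |(j : ℝ) - k|⁻¹ ≤ 2 * (harmonic N : ℝ) := by
  classical
  rw [← Finset.sum_filter_add_sum_filter_not S (fun k ↦ j < k)]
  have hR : ∑ k ∈ S.filter (fun k ↦ j < k), |(j : ℝ) - k|⁻¹ ≤ (harmonic N : ℝ) := by
    have h := sum_inv_sub_le_harmonic_right (S.filter (fun k ↦ j < k)) j N (fun k hk ↦ by
      rw [Finset.mem_filter] at hk
      have := hS k hk.1; exact ⟨hk.2, by omega⟩)
    refine le_trans (le_of_eq (Finset.sum_congr rfl fun k hk ↦ ?_)) h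
    rw [Finset.mem_filter] at hk
    rw [abs_sub_comm, abs_of_nonneg (sub_nonneg.2 (by exact_mod_cast hk.2.le))]
  have hL : ∑ k ∈ S.filter (fun k ↦ ¬ j < k), |(j : ℝ) - k|⁻¹ ≤ (harmonic N : ℝ) := by
    have h := sum_inv_sub_le_harmonic_left (S.filter (fun k ↦ ¬ j < k)) j N (fun k hk ↦ by
      rw [Finset.mem_filter] at hk
      have := hS k hk.1; exact ⟨by omega, by omega⟩)
    refine le_trans (le_of_eq (Finset.sum_congr rfl fun k hk ↦ ?_)) h
    rw [Finset.mem_filter] at hk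
    rw [abs_of_nonneg (sub_nonneg.2 (by exact_mod_cast (not_lt.1 hk.2)))]
  linarith

/-- **Harmonic far-sum bound, logarithmic form**: `Σ_{k∈S} |j − k|⁻¹ ≤ 2(1 + log N)` for indices
`k ≠ j` with `|j − k| ≤ N` (so `(Σ_far 1/|x_j − x_k|)² ≪ log⁴ J` once
`|x_j − x_k| ≫ |j − k|/log J`). [cite: RodgersTaoFMP2020, §6 proof of Prop. 15, FMP p. 39] -/
theorem sum_inv_dist_le_log (S : Finset ℕ) (j N : ℕ)
    (hS : ∀ k ∈ S, k ≠ j ∧ (j : ℤ) - N ≤ k ∧ (k : ℤ) ≤ j + N) :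
    ∑ k ∈ S, |(j : ℝ) - k|⁻¹ ≤ 2 * (1 + Real.log N) := by
  have h1 := sum_inv_dist_le_two_mul_harmonic S j N hS
  have h2 : (harmonic N : ℝ) ≤ 1 + Real.log N := harmonic_le_one_add_log N
  linarith

/-- **Square far-sum bound**: for indices `k` with `L ≤ |j − k|` (`L ≥ 1`),
`Σ_{k∈S} |j − k|⁻² ≤ 4/L` (both sides of `j`, via `Σ_{i>k} i⁻² ≤ 2/(k+1)`).
[cite: RodgersTaoFMP2020, §6 proof of Prop. 15, FMP p. 39 (uses of eq. (50) = arXiv (add))] -/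
theorem sum_inv_dist_sq_le (S : Finset ℕ) (j : ℕ) {L : ℕ} (hL : 1 ≤ L)
    (hS : ∀ k ∈ S, (L : ℤ) ≤ |(j : ℤ) - k|) :
    ∑ k ∈ S, (|(j : ℝ) - k| ^ 2)⁻¹ ≤ 4 / L := by
  classical
  -- a bound `M` for the elements of `S`
  obtain ⟨M, hM⟩ : ∃ M : ℕ, ∀ k ∈ S, k < M := ⟨S.sup id + 1, fun k hk ↦
    Nat.lt_succ_of_le (Finset.le_sup (f := id) hk)⟩
  rw [← Finset.sum_filter_add_sum_filter_not S (fun k ↦ j < k)]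
  -- right part: `k - j ∈ [L, M)`, injective
  have hR : ∑ k ∈ S.filter (fun k ↦ j < k), (|(j : ℝ) - k| ^ 2)⁻¹ ≤ 2 / L := by
    set S' := S.filter (fun k ↦ j < k) with hS'
    have hmem : ∀ k ∈ S', j < k ∧ L ≤ k - j ∧ k < M := by
      intro k hk
      rw [hS', Finset.mem_filter] at hk
      have h1 := hS k hk.1
      have h2 : j < k := hk.2
      refine ⟨h2, ?_, hM k hk.1⟩
      have : |(j : ℤ) - k| = (k : ℤ) - j := by
        rw [abs_sub_comm, abs_of_nonneg (by omega)]
      rw [this] at h1; omega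
    have hinj : Set.InjOn (fun k : ℕ ↦ k - j) S' := by
      intro k hk k' hk' h
      have := (hmem k hk).1; have := (hmem k' hk').1
      simp only at h; omega
    have himg : S'.image (fun k ↦ k - j) ⊆ Finset.Ioo (L - 1) M := by
      intro n hn
      obtain ⟨k, hk, rfl⟩ := Finset.mem_image.1 hn
      have := hmem k hk
      simp only [Finset.mem_Ioo]; omega
    calc ∑ k ∈ S', (|(j : ℝ) - k| ^ 2)⁻¹
          = ∑ n ∈ S'.image (fun k ↦ k - j), (((n : ℕ) : ℝ) ^ 2)⁻¹ := by
          rw [Finset.sum_image hinj]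
          refine Finset.sum_congr rfl fun k hk ↦ ?_
          have h1 := (hmem k hk).1
          rw [Nat.cast_sub h1.le, abs_sub_comm,
            abs_of_nonneg (sub_nonneg.2 (by exact_mod_cast h1.le))]
      _ ≤ ∑ n ∈ Finset.Ioo (L - 1) M, (((n : ℕ) : ℝ) ^ 2)⁻¹ :=
          Finset.sum_le_sum_of_subset_of_nonneg himg fun n _ _ ↦ by positivity
      _ ≤ 2 / ((L - 1 : ℕ) + 1) := sum_Ioo_inv_sq_le (L - 1) M
      _ = 2 / L := by rw [Nat.cast_sub hL]; push_cast; ring_nf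
  -- left part: `j - k ∈ [L, j+1)`, injective
  have hLft : ∑ k ∈ S.filter (fun k ↦ ¬ j < k), (|(j : ℝ) - k| ^ 2)⁻¹ ≤ 2 / L := by
    set S' := S.filter (fun k ↦ ¬ j < k) with hS'
    have hmem : ∀ k ∈ S', k ≤ j ∧ L ≤ j - k := by
      intro k hk
      rw [hS', Finset.mem_filter] at hk
      have h1 := hS k hk.1
      have h2 : k ≤ j := not_lt.1 hk.2
      refine ⟨h2, ?_⟩
      have : |(j : ℤ) - k| = (j : ℤ) - k := abs_of_nonneg (by omega)
      rw [this] at h1; omega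
    have hinj : Set.InjOn (fun k : ℕ ↦ j - k) S' := by
      intro k hk k' hk' h
      have := (hmem k hk); have := (hmem k' hk')
      simp only at h; omega
    have himg : S'.image (fun k ↦ j - k) ⊆ Finset.Ioo (L - 1) (j + 1) := by
      intro n hn
      obtain ⟨k, hk, rfl⟩ := Finset.mem_image.1 hn
      have := hmem k hk
      simp only [Finset.mem_Ioo]; omega
    calc ∑ k ∈ S', (|(j : ℝ) - k| ^ 2)⁻¹
          = ∑ n ∈ S'.image (fun k ↦ j - k), (((n : ℕ) : ℝ) ^ 2)⁻¹ := by
          rw [Finset.sum_image hinj]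
          refine Finset.sum_congr rfl fun k hk ↦ ?_
          have h1 := (hmem k hk).1
          rw [Nat.cast_sub h1, abs_of_nonneg (sub_nonneg.2 (by exact_mod_cast h1))]
      _ ≤ ∑ n ∈ Finset.Ioo (L - 1) (j + 1), (((n : ℕ) : ℝ) ^ 2)⁻¹ :=
          Finset.sum_le_sum_of_subset_of_nonneg himg fun n _ _ ↦ by positivity
      _ ≤ 2 / ((L - 1 : ℕ) + 1) := sum_Ioo_inv_sq_le (L - 1) (j + 1)
      _ = 2 / L := by rw [Nat.cast_sub hL]; push_cast; ring_nf
  have : (4 : ℝ) / L = 2 / L + 2 / L := by ring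
  rw [this]
  exact add_le_add hR hLft

/-! ## § E. Consecutive gaps between zeros -/

/-- **Consecutive-gap upper bound** («consecutive gaps are `O(log J)`» behind the crude lower
bound of FMP p. 38): `|x k − ξ k|, |x (k+1) − ξ (k+1)| ≤ E` and `ξ (k+1) − ξ k ≤ G` give
`x (k+1) − x k ≤ G + 2E`. [cite: RodgersTaoFMP2020, §6 proof of Prop. 15, FMP p. 38 (crude lower
bound via (add))] -/
theorem succ_sub_le_of_location {x ξ : ℕ → ℝ} {G E : ℝ} {k : ℕ} (hk : |x k - ξ k| ≤ E)
    (hk1 : |x (k + 1) - ξ (k + 1)| ≤ E) (hgap : ξ (k + 1) - ξ k ≤ G) :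
    x (k + 1) - x k ≤ G + 2 * E := by
  have := sub_le_sub_add_two_mul hk hk1
  linarith

/-- Consecutive-gap lower bound from the locations alone: `ξ (k+1) − ξ k ≥ g > 2E` forces
`x (k+1) − x k ≥ g − 2E > 0` (for nearby indices the assembly uses instead that the zeros are
simple and ordered).
[cite: RodgersTaoFMP2020, §6 proof of Prop. 15, FMP p. 38 (uses of eq. (50) = arXiv (add))] -/
theorem sub_sub_le_succ_sub_of_location {x ξ : ℕ → ℝ} {g E : ℝ} {k : ℕ} (hk : |x k - ξ k| ≤ E)
    (hk1 : |x (k + 1) - ξ (k + 1)| ≤ E) (hgap : g ≤ ξ (k + 1) - ξ k) :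
    g - 2 * E ≤ x (k + 1) - x k := by
  have := sub_sub_two_mul_le_sub hk hk1
  linarith

/-! ## § F. Spacing of the classical locations `ξ_j` (eq. (10)) -/

/-- The gap between consecutive classical locations is `4π/log(θ/4π)` for some
`θ ∈ (ξ_j, ξ_{j+1})` (mean value theorem for `Ψ`, proof of FMP Lemma 8 (ii)–(iii) = arXiv v5
Lemma 3.1). [cite: RodgersTaoFMP2020, Lemma 8 (proof), §3 (arXiv v5 Lemma 3.1)] -/
theorem exists_classicalLocation_succ_sub_eq {j : ℝ} (hj : -1 ≤ j) :
    ∃ θ : ℝ, classicalLocation j < θ ∧ θ < classicalLocation (j + 1) ∧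
      0 < Real.log (θ / (4 * π)) ∧
      classicalLocation (j + 1) - classicalLocation j = 4 * π / Real.log (θ / (4 * π)) := by
  obtain ⟨θ, h1, h2, h⟩ := exists_classicalLocation_gap_mul_eq_one hj
  have hπ : 0 < 4 * π := by positivity
  have hgap : 0 < classicalLocation (j + 1) - classicalLocation j := by
    linarith [strictMonoOn_classicalLocation hj (show -1 ≤ j + 1 by linarith) (by linarith)]
  -- `log(θ/4π) > 0` since the product is `1 > 0` and the gap is positive
  have hlog : 0 < Real.log (θ / (4 * π)) := by
    have hprod : 0 < (classicalLocation (j + 1) - classicalLocation j) *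
        (Real.log (θ / (4 * π)) / (4 * π)) := by rw [h]; exact one_pos
    have := (pos_iff_pos_of_mul_pos hprod).1 hgap
    exact (div_pos_iff_of_pos_right hπ).1 this
  refine ⟨θ, h1, h2, hlog, ?_⟩
  field_simp at h
  field_simp
  linarith

/-- Lower spacing of the classical locations: `4π/log(ξ_{j+1}/4π) ≤ ξ_{j+1} − ξ_j` for `j ≥ −1`.
[cite: RodgersTaoFMP2020, Lemma 8 (iii), §3 (arXiv v5 Lemma 3.1 (iii))] -/
theorem four_pi_div_log_le_classicalLocation_succ_sub {j : ℝ} (hj : -1 ≤ j) :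
    4 * π / Real.log (classicalLocation (j + 1) / (4 * π)) ≤
      classicalLocation (j + 1) - classicalLocation j := by
  obtain ⟨θ, h1, h2, hlog, h⟩ := exists_classicalLocation_succ_sub_eq hj
  have hπ : 0 < 4 * π := by positivity
  have hθ0 : 0 < θ := lt_trans (lt_of_lt_of_le hπ (four_pi_le_classicalLocation hj)) h1
  rw [h]
  refine div_le_div_of_nonneg_left (by positivity) hlog ?_
  exact Real.log_le_log (div_pos hθ0 hπ) (div_le_div_of_nonneg_right h2.le hπ.le)

/-- Upper spacing of the classical locations: `ξ_{j+1} − ξ_j ≤ 4π` for `j ≥ 0`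
(`ξ_0 = 4πe`, so `log(θ/4π) ≥ 1` on `(ξ_j, ξ_{j+1})`).
[cite: RodgersTaoFMP2020, Lemma 8 (iii), §3 (arXiv v5 Lemma 3.1 (iii))] -/
theorem classicalLocation_succ_sub_le_four_pi {j : ℝ} (hj : 0 ≤ j) :
    classicalLocation (j + 1) - classicalLocation j ≤ 4 * π := by
  have hj1 : -1 ≤ j := by linarith
  obtain ⟨θ, h1, _h2, hlog, h⟩ := exists_classicalLocation_succ_sub_eq hj1
  have hπ : 0 < 4 * π := by positivity
  -- `ξ_j ≥ 4πe` for `j ≥ 0` since `Ψ(4πe) = 0 ≤ j`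
  have he : 4 * π * Real.exp 1 ≤ classicalLocation j := by
    have h4 : 4 * π ≤ 4 * π * Real.exp 1 := by
      have : (1 : ℝ) ≤ Real.exp 1 := by linarith [Real.add_one_le_exp (1 : ℝ)]
      nlinarith [Real.pi_pos]
    rw [le_classicalLocation_iff_rodgersTaoPsi_le hj1 h4, rodgersTaoPsi_eq]
    have : 4 * π * Real.exp 1 / (4 * π) = Real.exp 1 := by field_simp
    rw [this, Real.log_exp]
    linarith
  have hθ : Real.exp 1 ≤ θ / (4 * π) := by
    rw [le_div_iff₀ hπ]
    linarith
  have hlog1 : 1 ≤ Real.log (θ / (4 * π)) := by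
    rw [← Real.log_exp 1]
    exact Real.log_le_log (Real.exp_pos 1) hθ
  rw [h, div_le_iff₀ hlog]
  nlinarith [Real.pi_pos]

/-- Size of the classical locations in the window: for `T ≥ 1` and `−1 ≤ j ≤ 4T log T`,
`log(ξ_j/4π) ≤ log(4T)` (from `ξ_j ≤ 16πT`).
[cite: RodgersTaoFMP2020, Lemma 8 (i), §3 (arXiv v5 Lemma 3.1 (i))] -/
theorem log_classicalLocation_div_four_pi_le {T j : ℝ} (hT : 1 ≤ T) (hj1 : -1 ≤ j)
    (hj : j ≤ 4 * T * Real.log T) :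
    Real.log (classicalLocation j / (4 * π)) ≤ Real.log (4 * T) := by
  have hπ : 0 < 4 * π := by positivity
  have h := classicalLocation_le_sixteen_pi_mul hT hj1 hj
  refine Real.log_le_log (div_pos (classicalLocation_pos hj1) hπ) ?_
  rw [div_le_iff₀ hπ]
  nlinarith [Real.pi_pos]

/-- **Spacing constants in the window** (what S4 instantiates): for `T ≥ 1` and natural indices
`k` with `k + 1 ≤ 4T log T`, `4π/log(4T) ≤ ξ_{k+1} − ξ_k ≤ 4π`.
[cite: RodgersTaoFMP2020, Lemma 8 (iii), §3; §6 proof of Prop. 15 (uses of (add) = eq. (50))] -/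
theorem classicalLocation_gaps_window {T : ℝ} (hT : 1 < T) (k : ℕ)
    (hk : (k : ℝ) + 1 ≤ 4 * T * Real.log T) :
    4 * π / Real.log (4 * T) ≤ classicalLocation ((k : ℝ) + 1) - classicalLocation (k : ℝ) ∧
      classicalLocation ((k : ℝ) + 1) - classicalLocation (k : ℝ) ≤ 4 * π := by
  have hk0 : (0 : ℝ) ≤ k := Nat.cast_nonneg k
  have hk1 : (-1 : ℝ) ≤ k := by linarith
  refine ⟨?_, classicalLocation_succ_sub_le_four_pi hk0⟩
  have hlog4T : 0 < Real.log (4 * T) := Real.log_pos (by linarith)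
  have h1 := four_pi_div_log_le_classicalLocation_succ_sub hk1
  have h2 := log_classicalLocation_div_four_pi_le hT.le (by linarith) hk
  -- `log(ξ_{k+1}/4π) > 0` (`ξ_{k+1} ≥ 4πe`)
  obtain ⟨θ, hθ1, hθ2, hlogθ, h⟩ := exists_classicalLocation_succ_sub_eq hk1
  have hπ : 0 < 4 * π := by positivity
  have hθ0 : 0 < θ := lt_trans (lt_of_lt_of_le hπ (four_pi_le_classicalLocation hk1)) hθ1
  have hlog1 : 0 < Real.log (classicalLocation ((k : ℝ) + 1) / (4 * π)) :=
    hlogθ.trans_le (Real.log_le_log (div_pos hθ0 hπ) (div_le_div_of_nonneg_right hθ2.le hπ.le))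
  exact (div_le_div_of_nonneg_left (by positivity) hlog1 h2).trans h1

end Literature.NumberTheory.LFunctions

end
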